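import Mathlib
import HarnessLib

/-!
# The discriminant of a split quartic (helper for item stmt-Langlands-13759, route PicardMuOrdinary)

Algebraic preliminaries for Dedekind's recipe: the discriminant is functorial under ring maps
preserving the degree (`discr_map`), the discriminant of `a ∏_{i<4} (X - rᵢ)` is
`a⁶ ∏_{i<j} (rᵢ - rⱼ)²` (`discr_C_mul_rootPoly`), and the image of a finite field with `q` elements
in a field is `{z | z^q = z}` (`mem_range_iff_pow_card_eq`).
-/

set_option linter.dupNamespace false -- project-wide option (lakefile weak.linter.dupNamespace); `Summit.Langlands.Langlands` is the mandated namespace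

noncomputable section

open scoped Polynomial
open Polynomial Finset

namespace Summit.Langlands.Langlands.Theorems.ResidualAutomorphyOdd

/-! ### The discriminant under a ring homomorphism -/

/-- The discriminant commutes with ring homomorphisms which do not kill the leading coefficient. -/
theorem discr_map {R S : Type*} [CommRing R] [IsDomain R] [CommRing S] [IsDomain S] (φ : R →+* S)
    {f : R[X]} (hf : φ f.leadingCoeff ≠ 0) : (f.map φ).discr = φ f.discr := by
  by_cases hdeg : f.natDegree = 0
  · obtain ⟨r, hr⟩ : ∃ r, f = C r := ⟨_, eq_C_of_natDegree_eq_zero hdeg⟩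
    rw [hr, map_C, discr_C, discr_C, map_one]
  have hpos : 0 < f.degree := by
    rw [← natDegree_pos_iff_degree_pos]; omega
  have hlead : (f.map φ).leadingCoeff = φ f.leadingCoeff := leadingCoeff_map_of_leadingCoeff_ne_zero _ hf
  have hnat : (f.map φ).natDegree = f.natDegree := natDegree_map_of_leadingCoeff_ne_zero _ hf
  have hpos' : 0 < (f.map φ).degree := by
    rw [← natDegree_pos_iff_degree_pos, hnat]; omega
  have h1 := resultant_deriv hpos
  have h2 := resultant_deriv hpos'
  rw [derivative_map, resultant_map_map, hnat, h1, hlead, map_mul, map_mul, map_pow, map_neg, map_one] at h2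
  have hne : ((-1 : S) ^ (f.natDegree * (f.natDegree - 1) / 2) * φ f.leadingCoeff) ≠ 0 :=
    mul_ne_zero (pow_ne_zero _ (by norm_num)) hf
  exact (mul_left_cancel₀ hne h2).symm

/-! ### The discriminant of a split quartic -/

section SplitQuartic

variable {L : Type*} [Field L]

/-- `univ.erase 0` in `Fin 4`. -/
theorem erase_zero_fin4 : (Finset.univ.erase (0 : Fin 4)) = {1, 2, 3} := by decide
/-- `univ.erase 1` in `Fin 4`. -/
theorem erase_one_fin4 : (Finset.univ.erase (1 : Fin 4)) = {0, 2, 3} := by decide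
/-- `univ.erase 2` in `Fin 4`. -/
theorem erase_two_fin4 : (Finset.univ.erase (2 : Fin 4)) = {0, 1, 3} := by decide
/-- `univ.erase 3` in `Fin 4`. -/
theorem erase_three_fin4 : (Finset.univ.erase (3 : Fin 4)) = {0, 1, 2} := by decide
/-- `Ioi 0` in `Fin 4`. -/
theorem Ioi_zero_fin4 : Finset.Ioi (0 : Fin 4) = {1, 2, 3} := by decide
/-- `Ioi 1` in `Fin 4`. -/
theorem Ioi_one_fin4 : Finset.Ioi (1 : Fin 4) = {2, 3} := by decide
/-- `Ioi 2` in `Fin 4`. -/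
theorem Ioi_two_fin4 : Finset.Ioi (2 : Fin 4) = {3} := by decide
/-- `Ioi 3` in `Fin 4`. -/
theorem Ioi_three_fin4 : Finset.Ioi (3 : Fin 4) = ∅ := by decide

/-- `∏_{i ≠ j} (rᵢ - rⱼ) = (∏_{i<j} (rᵢ - rⱼ))²` for four letters. -/
theorem prod_erase_eq_sq {R : Type*} [CommRing R] (r : Fin 4 → R) :
    ∏ i, ∏ j ∈ Finset.univ.erase i, (r i - r j) = (∏ i, ∏ j ∈ Finset.Ioi i, (r i - r j)) ^ 2 := by
  simp only [Fin.prod_univ_four, erase_zero_fin4, erase_one_fin4, erase_two_fin4, erase_three_fin4,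
    Ioi_zero_fin4, Ioi_one_fin4, Ioi_two_fin4, Ioi_three_fin4, Finset.prod_empty,
    Finset.prod_insert (show (1 : Fin 4) ∉ ({2, 3} : Finset (Fin 4)) by decide),
    Finset.prod_insert (show (0 : Fin 4) ∉ ({2, 3} : Finset (Fin 4)) by decide),
    Finset.prod_insert (show (0 : Fin 4) ∉ ({1, 3} : Finset (Fin 4)) by decide),
    Finset.prod_insert (show (0 : Fin 4) ∉ ({1, 2} : Finset (Fin 4)) by decide),
    Finset.prod_insert (show (1 : Fin 4) ∉ ({3} : Finset (Fin 4)) by decide),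
    Finset.prod_insert (show (1 : Fin 4) ∉ ({2} : Finset (Fin 4)) by decide),
    Finset.prod_insert (show (2 : Fin 4) ∉ ({3} : Finset (Fin 4)) by decide),
    Finset.prod_singleton]
  ring

/-- The monic quartic with prescribed roots. -/
def rootPoly (r : Fin 4 → L) : L[X] := ∏ i, (X - C (r i))

/-- `rootPoly` as a multiset product. -/
theorem rootPoly_eq_multiset (r : Fin 4 → L) :
    rootPoly r = ((Finset.univ.val.map r).map fun a => X - C a).prod := by
  rw [rootPoly, Finset.prod_eq_multiset_prod, Multiset.map_map]
  rfl

/-- The roots of `rootPoly r` are the `r i`. -/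
theorem roots_rootPoly (r : Fin 4 → L) : (rootPoly r).roots = Finset.univ.val.map r := by
  rw [rootPoly_eq_multiset, roots_multiset_prod_X_sub_C]

/-- `rootPoly r` splits. -/
theorem splits_rootPoly (r : Fin 4 → L) : (rootPoly r).Splits := by
  unfold rootPoly
  refine Splits.prod fun i _ => ?_
  rw [sub_eq_add_neg, ← map_neg C (r i)]
  exact Splits.X_add_C _

/-- `rootPoly r` is monic. -/
theorem monic_rootPoly (r : Fin 4 → L) : (rootPoly r).Monic := by
  unfold rootPoly
  exact monic_prod_of_monic _ _ fun i _ => monic_X_sub_C (r i)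

/-- `rootPoly r` has degree `4`. -/
theorem natDegree_rootPoly (r : Fin 4 → L) : (rootPoly r).natDegree = 4 := by
  unfold rootPoly
  rw [natDegree_prod_of_monic _ _ fun i _ => monic_X_sub_C (r i)]
  simp

/-- The derivative of `∏ (X - rᵢ)` at `r_k` is `∏_{j ≠ k} (r_k - r_j)`. -/
theorem eval_derivative_rootPoly (r : Fin 4 → L) (k : Fin 4) :
    (derivative (rootPoly r)).eval (r k) = ∏ j ∈ Finset.univ.erase k, (r k - r j) := by
  unfold rootPoly
  rw [derivative_prod_finset]
  · rw [eval_finsetSum]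
    rw [Finset.sum_eq_single k]
    · simp [eval_prod]
    · intro i _ hik
      rw [eval_mul, eval_prod]
      apply mul_eq_zero_of_left
      apply Finset.prod_eq_zero (Finset.mem_erase.2 ⟨Ne.symm hik, Finset.mem_univ k⟩)
      simp
    · intro hk; exact absurd (Finset.mem_univ k) hk

/-- **The discriminant of a split quartic**: for `f = a ∏ᵢ (X - rᵢ)`,
`disc f = a⁶ ∏_{i<j} (rᵢ - rⱼ)²`. -/
theorem discr_C_mul_rootPoly (r : Fin 4 → L) {a : L} (ha : a ≠ 0) :
    (C a * rootPoly r).discr = a ^ 6 * (∏ i, ∏ j ∈ Finset.Ioi i, (r i - r j)) ^ 2 := by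
  set f := C a * rootPoly r with hf
  have hdeg : f.natDegree = 4 := by rw [hf, natDegree_C_mul ha, natDegree_rootPoly]
  have hlead : f.leadingCoeff = a := by
    rw [hf, leadingCoeff_mul, leadingCoeff_C, (monic_rootPoly r).leadingCoeff, mul_one]
  have hpos : 0 < f.degree := by rw [← natDegree_pos_iff_degree_pos, hdeg]; norm_num
  have h1 := resultant_deriv hpos
  have hsplit : f.Splits := (splits_rootPoly r).C_mul a
  have h2 := resultant_eq_prod_eval f (derivative f) 3 (by
    have := natDegree_derivative_le f; rw [hdeg] at this; simpa using this) hsplit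
  rw [hdeg] at h1 h2
  norm_num at h1
  rw [h1, hlead] at h2
  -- the product over the roots
  have hroots : f.roots = Finset.univ.val.map r := by rw [hf, roots_C_mul _ ha, roots_rootPoly]
  have hderiv : ∀ k, (derivative f).eval (r k) = a * ∏ j ∈ Finset.univ.erase k, (r k - r j) := by
    intro k
    rw [hf, derivative_mul, derivative_C, zero_mul, zero_add, eval_mul, eval_C, eval_derivative_rootPoly]
  rw [hroots, Multiset.map_map] at h2
  have hprod : ((Finset.univ.val.map r).map ((fun x => eval x (derivative f)))).prod =
      a ^ 4 * ∏ i, ∏ j ∈ Finset.univ.erase i, (r i - r j) := by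
    rw [Multiset.map_map]
    change (Finset.univ.val.map fun i => eval (r i) (derivative f)).prod = _
    rw [← Finset.prod_eq_multiset_prod]
    simp_rw [hderiv]
    rw [Finset.prod_mul_distrib]
    simp
  rw [Multiset.map_map] at hprod
  rw [show ((fun x => eval x (derivative f)) ∘ r) = (fun x => eval x (derivative f)) ∘ r from rfl] at h2
  rw [hprod, prod_erase_eq_sq] at h2
  have : a * f.discr = a * (a ^ 6 * (∏ i, ∏ j ∈ Finset.Ioi i, (r i - r j)) ^ 2) := by
    rw [h2]; ring
  exact mul_left_cancel₀ ha this

end SplitQuartic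

/-! ### Finite subfields -/


/-- The image of a finite field of cardinality `q` in a field is `{z | z ^ q = z}`. -/
theorem mem_range_iff_pow_card_eq {F M : Type*} [Field F] [Fintype F] [Field M] (ι : F →+* M)
    (z : M) : z ∈ Set.range ι ↔ z ^ Fintype.card F = z := by
  classical
  constructor
  · rintro ⟨x, rfl⟩
    rw [← map_pow, FiniteField.pow_card]
  · intro hz
    set q := Fintype.card F with hq
    have h1 : 1 < q := Fintype.one_lt_card
    set T : Finset M := ((X ^ q - X : M[X]).roots).toFinset with hT
    have hne : (X ^ q - X : M[X]) ≠ 0 := FiniteField.X_pow_card_sub_X_ne_zero M h1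
    have hTcard : T.card ≤ q := by
      calc T.card ≤ Multiset.card (X ^ q - X : M[X]).roots := Multiset.toFinset_card_le _
        _ ≤ (X ^ q - X : M[X]).natDegree := card_roots' _
        _ = q := FiniteField.X_pow_card_sub_X_natDegree_eq M h1
    set U : Finset M := Finset.univ.image ι with hU
    have hUcard : U.card = q := by
      rw [hU, Finset.card_image_of_injective _ ι.injective, Finset.card_univ]
    have hUT : U ⊆ T := by
      intro w hw
      obtain ⟨x, -, rfl⟩ := Finset.mem_image.1 hw
      rw [hT, Multiset.mem_toFinset, mem_roots hne, IsRoot.def, eval_sub, eval_pow, eval_X, ← map_pow,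
        FiniteField.pow_card, sub_self]
    have hUT' : U = T := Finset.eq_of_subset_of_card_le hUT (by rw [hUcard]; exact hTcard)
    have hzT : z ∈ T := by
      rw [hT, Multiset.mem_toFinset, mem_roots hne, IsRoot.def, eval_sub, eval_pow, eval_X, hz, sub_self]
    rw [← hUT', hU, Finset.mem_image] at hzT
    obtain ⟨x, -, hx⟩ := hzT
    exact ⟨x, hx⟩

end Summit.Langlands.Langlands.Theorems.ResidualAutomorphyOdd
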